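import Mathlib
import Summits.Ventures.PercRepro2.TypedPendantPairTwo

/-!
# The pendant `o·b` pair, mirror census form: `b` a leaf at `o` (blind cell PercRepro2, mine-2
g53, 2026-08-29; `conjectures/MINE-2.md` M2-110 add. 1)

`TypedPendantPairNonneg.lean` / `TypedPendantPairTwo.lean` treat the census instances with `o` a
leaf at `b`; here the mirror: `b` a leaf at `o` by the typed edge `ebo` of class `≥ 1`, `o`
carrying exactly one further edge `gp = {o, x}`.  By night-3's leaf rule for `b`
(`typedCount_pendant_b`), the contraction of the pinned-open `o–b` edge onto `o`, the pinned loop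
and the restriction to the support, the instance reduces to the pair `o = b` hanging at `x`:
**`typedCount_nonneg_of_pendant_b_o`** (`gp` of class `1`: row 2′TRI holds outright) and
**`typedCount_pendant_b_o_two`** / **`typedCount_nonneg_of_pendant_b_o_two`** (`gp` of class `2`:
`N(τ) = C(2, τ ebo − 1) · [N(τ[ebo := 3][gp := 3]) + N(τ[ebo := 3][gp := 1])]`, and row 2′TRI
reduces to the contracted instance).  Own work; standard axioms.
-/

namespace Summit.Ventures.PercRepro2

namespace CovForm

namespace TypedRed

open OneTyped Contract Restrict

section Mirror

open Classical

variable {V : Type*} {E : Type*} [DecidableEq V] [Fintype E] [DecidableEq E] {R : Type*} [Field R]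
variable (ends : E → Sym2 V) (o a₁ a₂ a₃ b x : V)

/-- **The reduction chain of the mirror census instances**: `b` a leaf at `o` by `ebo`, `o`
carrying exactly the further edge `gp = {o, x}`; for every type vector with `ebo` of type `3` the
typed count is the count of the pair `o = b` at `x` on the restricted instance. -/
theorem typedCount_pendant_b_o_chain {gp ebo : E} (hgp : ends gp = s(o, x))
    (hebo : ends ebo = s(o, b)) (hleafb : ∀ e, b ∈ ends e → e = ebo)
    (hedgeo : ∀ e, o ∈ ends e → e = gp ∨ e = ebo)
    (h1b : a₁ ≠ b) (h1o : a₁ ≠ o) (h2b : a₂ ≠ b) (h2o : a₂ ≠ o) (h3b : a₃ ≠ b) (h3o : a₃ ≠ o)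
    (hox : o ≠ x) (hob : o ≠ b) (hbx : b ≠ x)
    (F : Finset E) (hgpF : gp ∈ F) (heboF : ebo ∈ F) (z : Config E) :
    ∃ (S : Finset E) (ends' : E → Sym2 V) (hgpS : gp ∈ S),
      rEnds S ends' ⟨gp, hgpS⟩ = s(o, x) ∧
      (∀ e : S, o ∈ rEnds S ends' e → e = ⟨gp, hgpS⟩) ∧
      (∀ τ' : E → ℕ, τ' ebo = 3 →
        typedCount F z τ' (K3 ends o a₁ a₂ a₃ b : Config E → Config E → Config E → R) =
          typedCount (rF S (F.erase ebo)) (rConfig S (Function.update z ebo false)) (rτ S τ')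
            (K3 (rEnds S ends') o a₁ a₂ a₃ o)) ∧
      (∀ τ' : E → ℕ, rτ S τ' ⟨gp, hgpS⟩ = τ' gp) ∧
      (rF S (F.erase ebo)).Nonempty ∧ ⟨gp, hgpS⟩ ∈ rF S (F.erase ebo) := by
  have hgpebo : gp ≠ ebo := by
    intro h
    rw [h, hebo, Sym2.eq_iff] at hgp
    rcases hgp with ⟨-, h1⟩ | ⟨h1, -⟩
    · exact hbx h1
    · exact hox h1
  -- the contraction of `ebo` onto `o`
  set W : Finset V := {o, b} with hW
  have hmem : ∀ v : V, v ∈ W ↔ v = o ∨ v = b := fun v => by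
    rw [hW, Finset.mem_insert, Finset.mem_singleton]
  have cmo : contractMap W o o = o := contractMap_of_mem ((hmem o).2 (Or.inl rfl))
  have cmb : contractMap W o b = o := contractMap_of_mem ((hmem b).2 (Or.inr rfl))
  have cmfix : ∀ v : V, v ≠ o → v ≠ b → contractMap W o v = v := fun v hv1 hv2 =>
    contractMap_of_notMem (fun h => by rcases (hmem v).1 h with h | h <;> contradiction)
  have cm1 := cmfix a₁ h1o h1b
  have cm2 := cmfix a₂ h2o h2b
  have cm3 := cmfix a₃ h3o h3b
  have cmx := cmfix x hox.symm hbx.symm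
  set ends' := contractEnds ends W o with hends'
  have hloop : ends' ebo = s(o, o) := by
    rw [hends', contractEnds_apply, hebo, Sym2.map_mk, cmo, cmb]
  have heboF' : ebo ∉ F.erase ebo := fun h => (Finset.mem_erase.1 h).1 rfl
  -- the support of the instance after the contraction
  set z' : Config E := Function.update z ebo false with hz'
  set S : Finset E := F.erase ebo ∪ Finset.univ.filter (fun e => z' e = true) with hS
  have hFS : F.erase ebo ⊆ S := Finset.subset_union_left
  have hzS : ∀ e, e ∉ S → z' e = false := by
    intro e he
    by_contra h
    exact he (Finset.mem_union_right _ (Finset.mem_filter.2 ⟨Finset.mem_univ e,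
      by simpa using h⟩))
  have heboS : ebo ∉ S := by
    intro h
    rcases Finset.mem_union.1 h with h | h
    · exact heboF' h
    · have := (Finset.mem_filter.1 h).2
      rw [hz', Function.update_self] at this
      exact Bool.false_ne_true this
  have hgpS : gp ∈ S := hFS (Finset.mem_erase.2 ⟨hgpebo, hgpF⟩)
  refine ⟨S, ends', hgpS, ?_, ?_, ?_, fun τ' => rfl, ⟨⟨gp, hgpS⟩, ?_⟩, ?_⟩
  · show ends' gp = _
    rw [hends', contractEnds_apply, hgp, Sym2.map_mk, cmo, cmx]
  · intro e he
    change o ∈ ends' e.1 at he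
    rw [hends', contractEnds_apply, Sym2.mem_map] at he
    obtain ⟨v, hv, hvo⟩ := he
    have hne : e.1 ≠ ebo := fun h => heboS (h ▸ e.2)
    refine Subtype.ext ?_
    by_cases hvW : v ∈ W
    · rcases (hmem v).1 hvW with rfl | rfl
      · rcases hedgeo e.1 hv with h | h
        · exact h
        · exact absurd h hne
      · exact absurd (hleafb e.1 hv) hne
    · rw [contractMap_of_notMem hvW] at hvo
      exact absurd ((hmem v).2 (Or.inl hvo)) hvW
  · intro τ' hτ'
    rw [typedCount_type_three F ebo heboF z _ hτ',
      typedCount_contract_open ends o a₁ a₂ a₃ b hebo (F.erase ebo) heboF'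
        (Function.update z ebo true) (Function.update_self ebo true z),
      cmo, cm1, cm2, cm3, cmb, ← hends',
      typedCount_pinned_loop ends' o a₁ a₂ a₃ o hloop (F.erase ebo) heboF' _
        (Function.update_self ebo true z), Function.update_idem, ← hz',
      typedCount_restrict S ends' o a₁ a₂ a₃ o hFS hzS]
  · exact mem_rF.2 (Finset.mem_erase.2 ⟨hgpebo, hgpF⟩)
  · exact mem_rF.2 (Finset.mem_erase.2 ⟨hgpebo, hgpF⟩)

variable [LinearOrder R] [IsStrictOrderedRing R]

/-- **Row 2′TRI on the mirror census pair instances, class `1`**: `b` a leaf at `o` by `ebo` of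
class `≥ 1`, `o` carrying exactly the further edge `gp = {o, x}` of class `1`. -/
theorem typedCount_nonneg_of_pendant_b_o {gp ebo : E} (hgp : ends gp = s(o, x))
    (hebo : ends ebo = s(o, b)) (hleafb : ∀ e, b ∈ ends e → e = ebo)
    (hedgeo : ∀ e, o ∈ ends e → e = gp ∨ e = ebo)
    (h1b : a₁ ≠ b) (h1o : a₁ ≠ o) (h2b : a₂ ≠ b) (h2o : a₂ ≠ o) (h3b : a₃ ≠ b) (h3o : a₃ ≠ o)
    (hox : o ≠ x) (hob : o ≠ b) (hbx : b ≠ x)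
    (F : Finset E) (hgpF : gp ∈ F) (heboF : ebo ∈ F) (z : Config E) (τ : E → ℕ)
    (hτp : τ gp = 1) (hτob : 1 ≤ τ ebo) :
    0 ≤ typedCount F z τ (K3 ends o a₁ a₂ a₃ b : Config E → Config E → Config E → R) := by
  obtain ⟨S, ends', hgpS, hgp', hleaf', chain, hrτ, -, hgpF'⟩ :=
    typedCount_pendant_b_o_chain (R := R) ends o a₁ a₂ a₃ b x hgp hebo hleafb hedgeo h1b h1o h2b
      h2o h3b h3o hox hob hbx F hgpF heboF z
  have hgpebo : gp ≠ ebo := by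
    intro h
    rw [h, hebo, Sym2.eq_iff] at hgp
    rcases hgp with ⟨-, h1⟩ | ⟨h1, -⟩
    · exact hbx h1
    · exact hox h1
  have hebo' : ends ebo = s(b, o) := by rw [hebo, Sym2.eq_swap]
  rw [typedCount_pendant_b ends o a₁ a₂ a₃ b hebo' hleafb hob.symm hob.symm h1b.symm h2b.symm h3b.symm
    F heboF z τ hτob]
  refine mul_nonneg (Nat.cast_nonneg _) ?_
  rw [chain _ (Function.update_self ebo 3 τ)]
  refine typedCount_nonneg_of_pendant_pair_one (rEnds S ends') a₁ a₂ a₃ o hgp' hleaf' hox h1o.symm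
    h2o.symm h3o.symm _ hgpF' _ _ ?_
  rw [hrτ, Function.update_of_ne hgpebo]; exact hτp

omit [LinearOrder R] [IsStrictOrderedRing R] in
/-- **The mirror census form of the class-`2` pair identity**: `b` a leaf at `o` by `ebo` of class
`≥ 1`, `o` carrying exactly the further edge `gp = {o, x}` of class `2`. -/
theorem typedCount_pendant_b_o_two {gp ebo : E} (hgp : ends gp = s(o, x))
    (hebo : ends ebo = s(o, b)) (hleafb : ∀ e, b ∈ ends e → e = ebo)
    (hedgeo : ∀ e, o ∈ ends e → e = gp ∨ e = ebo)
    (h1b : a₁ ≠ b) (h1o : a₁ ≠ o) (h2b : a₂ ≠ b) (h2o : a₂ ≠ o) (h3b : a₃ ≠ b) (h3o : a₃ ≠ o)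
    (hox : o ≠ x) (hob : o ≠ b) (hbx : b ≠ x)
    (F : Finset E) (hgpF : gp ∈ F) (heboF : ebo ∈ F) (z : Config E) (τ : E → ℕ)
    (hτp : τ gp = 2) (hτob : 1 ≤ τ ebo) :
    typedCount F z τ (K3 ends o a₁ a₂ a₃ b : Config E → Config E → Config E → R) =
      (Nat.choose 2 (τ ebo - 1) : R) *
        (typedCount F z (Function.update (Function.update τ ebo 3) gp 3) (K3 ends o a₁ a₂ a₃ b) +
          typedCount F z (Function.update (Function.update τ ebo 3) gp 1)
            (K3 ends o a₁ a₂ a₃ b)) := by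
  obtain ⟨S, ends', hgpS, hgp', hleaf', chain, hrτ, -, hgpF'⟩ :=
    typedCount_pendant_b_o_chain (R := R) ends o a₁ a₂ a₃ b x hgp hebo hleafb hedgeo h1b h1o h2b
      h2o h3b h3o hox hob hbx F hgpF heboF z
  have hgpebo : gp ≠ ebo := by
    intro h
    rw [h, hebo, Sym2.eq_iff] at hgp
    rcases hgp with ⟨-, h1⟩ | ⟨h1, -⟩
    · exact hbx h1
    · exact hox h1
  have h3 : ∀ k : ℕ, Function.update (Function.update τ ebo 3) gp k ebo = 3 := fun k => by
    rw [Function.update_of_ne hgpebo.symm, Function.update_self]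
  have hebo' : ends ebo = s(b, o) := by rw [hebo, Sym2.eq_swap]
  rw [typedCount_pendant_b ends o a₁ a₂ a₃ b hebo' hleafb hob.symm hob.symm h1b.symm h2b.symm h3b.symm
    F heboF z τ hτob]
  congr 1
  rw [chain _ (Function.update_self ebo 3 τ), chain _ (h3 3), chain _ (h3 1),
    rτ_update S _ hgpS 3, rτ_update S _ hgpS 1]
  refine typedCount_pendant_pair_two (rEnds S ends') a₁ a₂ a₃ o hgp' hleaf' hox h1o.symm h2o.symm
    h3o.symm _ hgpF' _ _ ?_
  rw [hrτ, Function.update_of_ne hgpebo]; exact hτp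

/-- **Row 2′TRI on the mirror class-`2` census pair instances reduces to the contracted
instance.** -/
theorem typedCount_nonneg_of_pendant_b_o_two {gp ebo : E} (hgp : ends gp = s(o, x))
    (hebo : ends ebo = s(o, b)) (hleafb : ∀ e, b ∈ ends e → e = ebo)
    (hedgeo : ∀ e, o ∈ ends e → e = gp ∨ e = ebo)
    (h1b : a₁ ≠ b) (h1o : a₁ ≠ o) (h2b : a₂ ≠ b) (h2o : a₂ ≠ o) (h3b : a₃ ≠ b) (h3o : a₃ ≠ o)
    (hox : o ≠ x) (hob : o ≠ b) (hbx : b ≠ x)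
    (F : Finset E) (hgpF : gp ∈ F) (heboF : ebo ∈ F) (z : Config E) (τ : E → ℕ)
    (hτp : τ gp = 2) (hτob : 1 ≤ τ ebo)
    (h3 : 0 ≤ typedCount F z (Function.update (Function.update τ ebo 3) gp 3)
      (K3 ends o a₁ a₂ a₃ b : Config E → Config E → Config E → R)) :
    0 ≤ typedCount F z τ (K3 ends o a₁ a₂ a₃ b : Config E → Config E → Config E → R) := by
  rw [typedCount_pendant_b_o_two ends o a₁ a₂ a₃ b x hgp hebo hleafb hedgeo h1b h1o h2b h2o h3b
    h3o hox hob hbx F hgpF heboF z τ hτp hτob]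
  have hgpebo : gp ≠ ebo := by
    intro h
    rw [h, hebo, Sym2.eq_iff] at hgp
    rcases hgp with ⟨-, h1⟩ | ⟨h1, -⟩
    · exact hbx h1
    · exact hox h1
  refine mul_nonneg (Nat.cast_nonneg _) (add_nonneg h3 ?_)
  refine typedCount_nonneg_of_pendant_b_o ends o a₁ a₂ a₃ b x hgp hebo hleafb hedgeo h1b h1o h2b
    h2o h3b h3o hox hob hbx F hgpF heboF z _ (Function.update_self gp 1 _) ?_
  rw [Function.update_of_ne hgpebo.symm, Function.update_self]
  norm_num

end Mirror

end TypedRed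

end CovForm

end Summit.Ventures.PercRepro2
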